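import Summits.QuantumFields.YangMills.Theorems.FluctuationComparisonRegPrIntLS2BetaCornerSquareStokes
import Summits.QuantumFields.YangMills.Theorems.FluctuationComparisonRegPrIntLS2BetaSchurTest
import HarnessLib

/-!
# S2β · `hFlat` road, UV3-NODE §57.8 (C) ∕ §64.2–§64.4 — THE ONE-LEVEL TENT KERNEL ON THE `Setup` TORUS: row sums `L²` EXACTLY, column sums `≤ L^{2−d}` (`= L⁻¹`),
# hence `‖T_t‖_{ℓ²→ℓ²} ≤ √L` by the Schur test with constant ONE (the docking of ✓p815896 G7 ∕ ✓p816252 G8 onto `Plaq P t` ∕ `Site P (t+1)`)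

Cell `ym3-torus` (rung R3 = continuum `SU(2)` Yang–Mills on the three-torus — NOT d = 4, NOT infinite volume, NOT a mass gap, NOT Clay).
Width seat «width 12» `ym3-torus-px12` (gen 23), FREE px helper on crux `stmt-QuantumFields-20520` (`Theses.UnitScaleTilt.FluctuationComparisonRegPrIntL`),
count-neutral, DEFINITION-FREE (the kernel is written out in every statement as `(L^d)⁻¹ · #((block z).filter …)`; pen NAMED by px8 g21 07:52:08Z, shape wish (R)(C)(N)).

THE KERNEL (px8 g21 §57.8 (A)∕(C), §64.2: «`T_t` has row sums `L²` and column sums `L⁻¹` EXACTLY — the fine plaquette fixes the height of `x`, `L²` in-plane positions»).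
Fix a plane `μ < ν` of `T^{(t)}` (standing range `t + 1 ≤ m + K`, so `L < |T^{(t)}|` and nothing wraps).  For a coarse site `z ∈ T^{(t+1)}` (the coarse plaquette `⟨z; μ,ν⟩`)
and a fine plaquette `p`:
    `K z p := (L^d)⁻¹ · #{x ∈ B(z) : p ∈ □_L(x; μ,ν)}`,   `□_L(x; μ,ν) := {⟨x + a e_μ + b e_ν; μ, ν⟩ : a, b < L}`
— the corner-MEAN over the block of the indicator of the filled flat square of side `L` (✓p814030's corner-square family, px21 g21; the coupled form of the
averaged plaquette loop, §57.8 (A)), written with the membership predicate spelled out componentwise (`p.μ = μ ∧ p.ν = ν ∧ ∃ a b < L, p.src = x + a e_μ + b e_ν`).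
* §1 `shiftN_apply_self∕_ne`, `natCast_inj_of_lt`, `L_lt_sitesPerDir`, `eq_shiftN_shiftN_iff`, ★`card_square` (`#□_L(x) = L²`), ★`card_corners` (an in-plane plaquette has
  exactly `L²` corners `x` with `p ∈ □_L(x)`), `card_corners_eq_zero` (out of plane: none).
* §2 `sum_card_corners_block` (ROW COUNT `L^d·L²`, double counting), `sum_card_corners_le` (COLUMN COUNT `≤ L²`: the blocks partition the torus, `Finset.card_eq_sum_card_fiberwise`),
  ★★`tentKernel_row` **(R) `Σ_p K z p = L²`**, ★★`tentKernel_col` **(C) `Σ_z K z p ≤ (L^d)⁻¹·L²`** (`tentKernel_col_three`: `≤ L⁻¹`), `tentKernel_nonneg` **(N)**.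
* §3 ★★★`tentKernel_schur` — `Σ_z (Σ_p K z p · g p)² ≤ L²·((L^d)⁻¹·L²)·Σ_p g p²` by ✓`schur_test_sq`; `tentKernel_schur_three`: **`≤ L · Σ_p g p²`** — the KEY LEMMA's one-level
  factor `√L` with constant ONE (§64.2), for EVERY `g` (the assembler feeds `g = dist1 U(∂p)`-type fluxes and multiplies the levels with ✓p816252's product lemmas ∕
  ✓`…ContractingSupRecursion.upward_sqrtL_le`).

HONEST SCOPE.  Finite combinatorics on the `Setup` torus; no group, no analysis; nothing of Bałaban's is asserted ([Balaban1985Averaging] (19) p.21 ∕ [Balaban1984PropagatorsI]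
(1.7) p.18 are the printed loci of the plaquette ∕ contour bookkeeping served); the KEY LEMMA, `hFlat`, TUBE-REG∘, GAP♯∘, S2β, crux 20520 and `YM3TorusSU2` are NOT proved; no
registered stub is closed; the Yang–Mills mass gap is NOT proved.
References: T. Bałaban, CMP **98** (1985) 17–51 [Balaban1985Averaging] ((19) p.21); CMP **95** (1984) 17–40 [Balaban1984PropagatorsI] ((1.7) p.18).
-/

set_option autoImplicit false

namespace Summit.QuantumFields.YangMills.Theorems.FluctuationComparisonRegPrIntLS2BetaTentKernelTorus

open Finset
open Literature.MathematicalPhysics.QuantumFieldTheory.Balaban1983to89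
open B10Eq47AxialChi (shiftN shiftN_zero shiftN_succ)

variable {P : Params} {t : ℕ}

/-! ## §1 Coordinates of iterated shifts; the `L²` plaquettes of a cornered square are distinct -/

/-- `(x + n e_μ)_μ = x_μ + n`. [folklore] -/
theorem shiftN_apply_self (x : Site P t) (μ : Fin P.d) : ∀ n : ℕ, shiftN x μ n μ = x μ + n
  | 0 => by simp
  | n + 1 => by rw [shiftN_succ]; simp [Site.shift, shiftN_apply_self x μ n, add_assoc]

/-- `(x + n e_μ)_κ = x_κ` for `κ ≠ μ`. [folklore] -/
theorem shiftN_apply_ne (x : Site P t) {μ κ : Fin P.d} (h : κ ≠ μ) : ∀ n : ℕ, shiftN x μ n κ = x κ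
  | 0 => by simp
  | n + 1 => by rw [shiftN_succ]; simp [Site.shift, Function.update_of_ne h, shiftN_apply_ne x h n]

/-- Small natural numbers are distinct on the circle: `a, a′ < N`, `(a : ℤ∕N) = a′ ⟹ a = a′`. [folklore] -/
theorem natCast_inj_of_lt {N : ℕ} {a a' : ℕ} (ha : a < N) (ha' : a' < N) (h : (a : ZMod N) = a') : a = a' := by
  have := (ZMod.natCast_eq_natCast_iff' a a' N).mp h
  rwa [Nat.mod_eq_of_lt ha, Nat.mod_eq_of_lt ha'] at this

/-- `L < |T^{(t)}|_ν` in the standing range. [folklore] -/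
theorem L_lt_sitesPerDir (ht : t + 1 ≤ P.m + P.K) : P.L < P.sitesPerDir t := by
  rw [P.sitesPerDir_eq_mul_succ ht]
  have := P.one_lt_sitesPerDir (t + 1); have := P.L_pos; nlinarith

/-- Shifting determines the site from its coordinates: `x′ = x + a e_μ + b e_ν` iff `x` is `x′` with `a`, `b` subtracted in the coordinates `μ ≠ ν`. [folklore] -/
theorem eq_shiftN_shiftN_iff (x x' : Site P t) {μ ν : Fin P.d} (h : μ ≠ ν) (a b : ℕ) :
    x' = shiftN (shiftN x μ a) ν b ↔ x = fun κ => if κ = μ then x' μ - a else if κ = ν then x' ν - b else x' κ := by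
  constructor
  · rintro rfl
    funext κ
    by_cases hκμ : κ = μ
    · subst hκμ; rw [if_pos rfl, shiftN_apply_ne _ h, shiftN_apply_self, add_sub_cancel_right]
    · rw [if_neg hκμ]
      by_cases hκν : κ = ν
      · subst hκν; rw [if_pos rfl, shiftN_apply_self, shiftN_apply_ne _ hκμ, add_sub_cancel_right]
      · rw [if_neg hκν, shiftN_apply_ne _ hκν, shiftN_apply_ne _ hκμ]
  · rintro rfl
    funext κ
    by_cases hκν : κ = ν
    · subst hκν; rw [shiftN_apply_self, shiftN_apply_ne _ h.symm, if_neg h.symm, if_pos rfl, sub_add_cancel]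
    · rw [shiftN_apply_ne _ hκν]
      by_cases hκμ : κ = μ
      · subst hκμ; rw [shiftN_apply_self, if_pos rfl, sub_add_cancel]
      · rw [shiftN_apply_ne _ hκμ, if_neg hκμ, if_neg hκν]

/-- ★ **A CORNERED SQUARE OF SIDE `L` HAS EXACTLY `L²` PLAQUETTES**: the fine plaquettes `⟨x + a e_μ + b e_ν; μ, ν⟩`, `a, b < L`, are pairwise distinct
(no wrap-around: `L < |T^{(t)}|`). [folklore] -/
theorem card_square (ht : t + 1 ≤ P.m + P.K) (x : Site P t) {μ ν : Fin P.d} (h : μ < ν) :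
    (Finset.univ.filter (fun p : Plaq P t => p.μ = μ ∧ p.ν = ν ∧
      ∃ a ∈ range P.L, ∃ b ∈ range P.L, p.src = shiftN (shiftN x μ a) ν b)).card = P.L ^ 2 := by
  have hN := L_lt_sitesPerDir ht
  rw [show P.L ^ 2 = (range P.L ×ˢ range P.L).card by rw [Finset.card_product, Finset.card_range, sq]]
  symm
  refine Finset.card_bij (fun ab _ => (⟨shiftN (shiftN x μ ab.1) ν ab.2, μ, ν, h⟩ : Plaq P t)) (fun ab hab => ?_) (fun ab hab ab' hab' heq => ?_)
    (fun p hp => ?_)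
  · rw [Finset.mem_product] at hab
    exact Finset.mem_filter.mpr ⟨Finset.mem_univ _, rfl, rfl, ab.1, hab.1, ab.2, hab.2, rfl⟩
  · simp only [Finset.mem_product, Finset.mem_range] at hab hab'
    have hsrc : shiftN (shiftN x μ ab.1) ν ab.2 = shiftN (shiftN x μ ab'.1) ν ab'.2 := congrArg Plaq.src heq
    have hμ := congrFun hsrc μ
    have hν := congrFun hsrc ν
    rw [shiftN_apply_ne _ h.ne, shiftN_apply_ne _ h.ne, shiftN_apply_self, shiftN_apply_self] at hμ
    rw [shiftN_apply_self, shiftN_apply_self, shiftN_apply_ne _ h.ne', shiftN_apply_ne _ h.ne'] at hν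
    exact Prod.ext (natCast_inj_of_lt (hab.1.trans hN) (hab'.1.trans hN) (add_left_cancel hμ))
      (natCast_inj_of_lt (hab.2.trans hN) (hab'.2.trans hN) (add_left_cancel hν))
  · obtain ⟨-, hμ, hν, a, ha, b, hb, hsrc⟩ := Finset.mem_filter.mp hp
    refine ⟨(a, b), Finset.mem_product.mpr ⟨ha, hb⟩, ?_⟩
    obtain ⟨src, pμ, pν, hp'⟩ := p
    simp only at hμ hν hsrc
    subst hμ hν hsrc
    rfl

/-- ★ **EVERY IN-PLANE FINE PLAQUETTE IS IN EXACTLY `L²` CORNERED SQUARES** (the corners `x = p₋ − a e_μ − b e_ν`, `a, b < L`, are pairwise distinct). [folklore] -/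
theorem card_corners (ht : t + 1 ≤ P.m + P.K) (p : Plaq P t) :
    (Finset.univ.filter (fun x : Site P t => ∃ a ∈ range P.L, ∃ b ∈ range P.L, p.src = shiftN (shiftN x p.μ a) p.ν b)).card = P.L ^ 2 := by
  have hN := L_lt_sitesPerDir ht
  have hne : p.μ ≠ p.ν := p.hμν.ne
  rw [show P.L ^ 2 = (range P.L ×ˢ range P.L).card by rw [Finset.card_product, Finset.card_range, sq]]
  symm
  refine Finset.card_bij (fun ab _ => fun κ => if κ = p.μ then p.src p.μ - ab.1 else if κ = p.ν then p.src p.ν - ab.2 else p.src κ)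
    (fun ab hab => ?_) (fun ab hab ab' hab' heq => ?_) (fun x hx => ?_)
  · rw [Finset.mem_product] at hab
    exact Finset.mem_filter.mpr ⟨Finset.mem_univ _, ab.1, hab.1, ab.2, hab.2, (eq_shiftN_shiftN_iff _ _ hne _ _).mpr rfl⟩
  · simp only [Finset.mem_product, Finset.mem_range] at hab hab'
    have hμ := congrFun heq p.μ
    have hν := congrFun heq p.ν
    rw [if_pos rfl, if_pos rfl] at hμ
    rw [if_neg hne.symm, if_neg hne.symm, if_pos rfl, if_pos rfl] at hν
    exact Prod.ext (natCast_inj_of_lt (hab.1.trans hN) (hab'.1.trans hN) (sub_right_injective hμ))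
      (natCast_inj_of_lt (hab.2.trans hN) (hab'.2.trans hN) (sub_right_injective hν))
  · obtain ⟨-, a, ha, b, hb, hsrc⟩ := Finset.mem_filter.mp hx
    exact ⟨(a, b), Finset.mem_product.mpr ⟨ha, hb⟩, ((eq_shiftN_shiftN_iff _ _ hne _ _).mp hsrc).symm⟩

/-- Out of plane, no cornered square of the `(μ,ν)`-family contains the plaquette. [folklore] -/
theorem card_corners_eq_zero {μ ν : Fin P.d} (p : Plaq P t) (hp : ¬(p.μ = μ ∧ p.ν = ν)) (s : Finset (Site P t)) :
    (s.filter (fun x : Site P t => p.μ = μ ∧ p.ν = ν ∧ ∃ a ∈ range P.L, ∃ b ∈ range P.L, p.src = shiftN (shiftN x μ a) ν b)).card = 0 := by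
  rw [Finset.card_eq_zero, Finset.filter_eq_empty_iff]
  exact fun x _ hx => hp ⟨hx.1, hx.2.1⟩

/-! ## §2 The tent kernel of one averaging step: row sums `L²`, column sums `L^{2−d}`, non-negative -/

/-- **ROW COUNT**: summed over all fine plaquettes, the corner counts of the block of `z` total `|B(z)| · L² = L^d · L²`. [folklore] -/
theorem sum_card_corners_block (ht : t + 1 ≤ P.m + P.K) (z : Site P (t + 1)) {μ ν : Fin P.d} (h : μ < ν) :
    ∑ p : Plaq P t, ((block z).filter (fun x : Site P t => p.μ = μ ∧ p.ν = ν ∧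
      ∃ a ∈ range P.L, ∃ b ∈ range P.L, p.src = shiftN (shiftN x μ a) ν b)).card = P.L ^ P.d * P.L ^ 2 := by
  simp only [Finset.card_filter]
  rw [Finset.sum_comm]
  have hx : ∀ x ∈ block z, ∑ p : Plaq P t, (if (p.μ = μ ∧ p.ν = ν ∧ ∃ a ∈ range P.L, ∃ b ∈ range P.L, p.src = shiftN (shiftN x μ a) ν b)
      then 1 else 0) = P.L ^ 2 := fun x _ => by rw [← Finset.card_filter, card_square ht x h]
  rw [Finset.sum_congr rfl hx, Finset.sum_const, smul_eq_mul, Site.card_block ht]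

/-- **COLUMN COUNT**: summed over all blocks, the corner counts of a fine plaquette total its number of corners — `L²` in plane, `0` out of plane; so `≤ L²`. [folklore] -/
theorem sum_card_corners_le (ht : t + 1 ≤ P.m + P.K) (p : Plaq P t) (μ ν : Fin P.d) :
    ∑ z : Site P (t + 1), ((block z).filter (fun x : Site P t => p.μ = μ ∧ p.ν = ν ∧
      ∃ a ∈ range P.L, ∃ b ∈ range P.L, p.src = shiftN (shiftN x μ a) ν b)).card ≤ P.L ^ 2 := by
  classical
  -- the blocks partition the fine torus
  have hfib : ∑ z : Site P (t + 1), ((block z).filter (fun x : Site P t => p.μ = μ ∧ p.ν = ν ∧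
      ∃ a ∈ range P.L, ∃ b ∈ range P.L, p.src = shiftN (shiftN x μ a) ν b)).card
      = (Finset.univ.filter (fun x : Site P t => p.μ = μ ∧ p.ν = ν ∧
          ∃ a ∈ range P.L, ∃ b ∈ range P.L, p.src = shiftN (shiftN x μ a) ν b)).card := by
    rw [Finset.card_eq_sum_card_fiberwise (f := blockOf) (t := Finset.univ) fun _ _ => Finset.mem_coe.mpr (Finset.mem_univ _)]
    refine Finset.sum_congr rfl fun z _ => ?_
    rw [block, Finset.filter_filter, Finset.filter_filter]
    exact congrArg Finset.card (Finset.filter_congr fun x _ => and_comm)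
  rw [hfib]
  by_cases hp : p.μ = μ ∧ p.ν = ν
  · obtain ⟨hμ, hν⟩ := hp
    subst hμ hν
    rw [Finset.filter_congr (q := fun x : Site P t => ∃ a ∈ range P.L, ∃ b ∈ range P.L, p.src = shiftN (shiftN x p.μ a) p.ν b)
      fun x _ => by simp only [true_and], card_corners ht p]
  · rw [card_corners_eq_zero p hp]; exact Nat.zero_le _

/-- ★★ **(R) ROW SUMS `L²` EXACTLY**: the tent kernel `K z p := (L^d)⁻¹ · #{x ∈ B(z) : p ∈ □_L(x; μ,ν)}` of one averaging step has `Σ_p K z p = L²`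
(standing range; `μ < ν`). [cite: Balaban1985Averaging, (19) p.21] -/
theorem tentKernel_row (ht : t + 1 ≤ P.m + P.K) (z : Site P (t + 1)) {μ ν : Fin P.d} (h : μ < ν) :
    ∑ p : Plaq P t, ((P.L : ℝ) ^ P.d)⁻¹ * (((block z).filter (fun x : Site P t => p.μ = μ ∧ p.ν = ν ∧
      ∃ a ∈ range P.L, ∃ b ∈ range P.L, p.src = shiftN (shiftN x μ a) ν b)).card : ℝ) = (P.L : ℝ) ^ 2 := by
  rw [← Finset.mul_sum, ← Nat.cast_sum, sum_card_corners_block ht z h]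
  have hL : (P.L : ℝ) ^ P.d ≠ 0 := pow_ne_zero _ (Nat.cast_pos.mpr P.L_pos).ne'
  push_cast
  rw [← mul_assoc, inv_mul_cancel₀ hL, one_mul]

/-- ★★ **(C) COLUMN SUMS `≤ L²·(L^d)⁻¹ = L^{2−d}`** (`= L⁻¹` in `d = 3`; equality in plane, `0` out of plane). [cite: Balaban1985Averaging, (19) p.21] -/
theorem tentKernel_col (ht : t + 1 ≤ P.m + P.K) (p : Plaq P t) (μ ν : Fin P.d) :
    ∑ z : Site P (t + 1), ((P.L : ℝ) ^ P.d)⁻¹ * (((block z).filter (fun x : Site P t => p.μ = μ ∧ p.ν = ν ∧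
      ∃ a ∈ range P.L, ∃ b ∈ range P.L, p.src = shiftN (shiftN x μ a) ν b)).card : ℝ) ≤ ((P.L : ℝ) ^ P.d)⁻¹ * (P.L : ℝ) ^ 2 := by
  rw [← Finset.mul_sum, ← Nat.cast_sum]
  refine mul_le_mul_of_nonneg_left ?_ (inv_nonneg.mpr (pow_nonneg (Nat.cast_nonneg _) _))
  exact_mod_cast sum_card_corners_le ht p μ ν

/-- **(N) the kernel is non-negative.** [folklore] -/
theorem tentKernel_nonneg (z : Site P (t + 1)) (p : Plaq P t) (μ ν : Fin P.d) :
    0 ≤ ((P.L : ℝ) ^ P.d)⁻¹ * (((block z).filter (fun x : Site P t => p.μ = μ ∧ p.ν = ν ∧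
      ∃ a ∈ range P.L, ∃ b ∈ range P.L, p.src = shiftN (shiftN x μ a) ν b)).card : ℝ) :=
  mul_nonneg (inv_nonneg.mpr (pow_nonneg (Nat.cast_nonneg _) _)) (Nat.cast_nonneg _)

/-- The `d = 3` reading of (C): column sums `≤ L⁻¹`. [cite: Balaban1985Averaging, (19) p.21] -/
theorem tentKernel_col_three (hd : P.d = 3) (ht : t + 1 ≤ P.m + P.K) (p : Plaq P t) (μ ν : Fin P.d) :
    ∑ z : Site P (t + 1), ((P.L : ℝ) ^ P.d)⁻¹ * (((block z).filter (fun x : Site P t => p.μ = μ ∧ p.ν = ν ∧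
      ∃ a ∈ range P.L, ∃ b ∈ range P.L, p.src = shiftN (shiftN x μ a) ν b)).card : ℝ) ≤ (P.L : ℝ)⁻¹ := by
  refine (tentKernel_col ht p μ ν).trans (le_of_eq ?_)
  have hL : (P.L : ℝ) ≠ 0 := (Nat.cast_pos.mpr P.L_pos).ne'
  rw [hd]; field_simp

/-! ## §3 The Schur bound: `‖T_t‖_{ℓ² → ℓ²}² ≤ L² · L^{2−d}` (`= L` in `d = 3`) -/

/-- ★★★ **THE ONE-LEVEL TENT OPERATOR IS `ℓ²`-BOUNDED BY `√(L²·L^{2−d})`** (= `√L` in `d = 3`, constant ONE): for every function `g` of the fine plaquettes,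
`Σ_z (Σ_p K z p · g p)² ≤ L² · (L^d)⁻¹·L² · Σ_p g p²` — ✓`…S2BetaSchurTest.schur_test_sq` with (R), (C), (N). [cite: Balaban1985Averaging, (19) p.21] -/
theorem tentKernel_schur (ht : t + 1 ≤ P.m + P.K) {μ ν : Fin P.d} (h : μ < ν) (g : Plaq P t → ℝ) :
    ∑ z : Site P (t + 1), (∑ p : Plaq P t, ((P.L : ℝ) ^ P.d)⁻¹ * (((block z).filter (fun x : Site P t => p.μ = μ ∧ p.ν = ν ∧
      ∃ a ∈ range P.L, ∃ b ∈ range P.L, p.src = shiftN (shiftN x μ a) ν b)).card : ℝ) * g p) ^ 2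
      ≤ (P.L : ℝ) ^ 2 * (((P.L : ℝ) ^ P.d)⁻¹ * (P.L : ℝ) ^ 2) * ∑ p : Plaq P t, g p ^ 2 :=
  FluctuationComparisonRegPrIntLS2BetaSchurTest.schur_test_sq Finset.univ Finset.univ _ (fun z _ p _ => tentKernel_nonneg z p μ ν)
    (pow_nonneg (Nat.cast_nonneg _) 2) (fun z _ => (tentKernel_row ht z h).le) (fun p _ => tentKernel_col ht p μ ν) g

/-- The `d = 3` reading: `Σ_z (T g)(z)² ≤ L · Σ_p g p²` — the KEY LEMMA's one-level factor `√L` (UV3-NODE §57.8 (C), §64.2), on the nose. [cite: Balaban1985Averaging, (19) p.21] -/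
theorem tentKernel_schur_three (hd : P.d = 3) (ht : t + 1 ≤ P.m + P.K) {μ ν : Fin P.d} (h : μ < ν) (g : Plaq P t → ℝ) :
    ∑ z : Site P (t + 1), (∑ p : Plaq P t, ((P.L : ℝ) ^ P.d)⁻¹ * (((block z).filter (fun x : Site P t => p.μ = μ ∧ p.ν = ν ∧
      ∃ a ∈ range P.L, ∃ b ∈ range P.L, p.src = shiftN (shiftN x μ a) ν b)).card : ℝ) * g p) ^ 2
      ≤ (P.L : ℝ) * ∑ p : Plaq P t, g p ^ 2 := by
  refine (tentKernel_schur ht h g).trans (le_of_eq ?_)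
  have hL : (P.L : ℝ) ≠ 0 := (Nat.cast_pos.mpr P.L_pos).ne'
  rw [hd]; field_simp

end Summit.QuantumFields.YangMills.Theorems.FluctuationComparisonRegPrIntLS2BetaTentKernelTorus
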